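import Summits.QuantumFields.YangMills.Theorems.LocalInsertionMomentOfWindowTail
import Summits.QuantumFields.YangMills.Theorems.LocalInsertionWindowTailOfConcentration
import Summits.QuantumFields.YangMills.Theorems.PoincareLipschitzLevelOneLipschitz
import Summits.QuantumFields.YangMills.Theses.PoincareLipschitz
import HarnessLib

/-!
# Line «local_insertion» on crux `HistoryTailL` (stmt-QuantumFields-19936) — THE INSERTION STEP FROM CONCENTRATION (engine (E3) by kernel,
# by-name layer): K1 ∧ K2 ∧ median at scale `g` ⇒ the LocalInsertionL integrand bound at one instance, EVERY `ε ≥ 0`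

Cell `ym3-torus` (YM ladder rung R3 = continuum SU(2) Yang–Mills on the three-torus — a RUNG, NOT the Clay problem: not d = 4, not
infinite volume, not a mass gap), width seat `ym-ust-19936-w3` gen 11, `--supports stmt-QuantumFields-19936 --as helper`; LEAD ★w1-19936 g6
lettering 23:03:33Z.  THEOREMS ONLY, definition-free.  This thin file sits in the route cone (it imports file A, which names
`Theses.LocalInsertion.LocalInsertionL`); the heavy McShane step lives route-independently in ✓`LocalInsertionWindowTailOfConcentration`.
HONEST FRAMING: CONDITIONAL one-height steps — hypotheses `hK1` (text of `MesoscopicConcentrationL`, stmt-23532, one `(F,γ,K)`), `hK2` (text of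
`BlockLipschitzL`, stmt-23533, one plaquette; ✓`stub_levelOneLipschitz` at `j = 1`) and the centring row at scale `g` (median `hMed`, or mean
`hMean` + `hGc`) are NOT in the tree.  Nothing of `LocalInsertionL` (23607), 23608, the stubs of `Cruxes/HistoryTailL/Lines/local_insertion.lean`,
the crux `HistoryTailL` or any summit statement is proved.

* ★★`insertion_step` (median form): ✓`WindowTailOfConcentration.windowTail_step` (Gaussian window tail beyond `t₀ = 2(m + (CL+1)√(578Cc/cc))`,
  rate `c = cc/(1156(CL+1)²)`) + ✓`MomentOfWindowTail.insertionIntegral_le_of_gaussTail` ⇒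
  `∫_{G(a,j)} exp(ε·min(dist1(Ū^j(∂a))/g, p(g))) ∂Gibbs_K ≤ (t₀+1)·e^{ε(t₀+1)} + 2Cc·e^{ε + (ε+1)²/(4c)}` — every `ε ≥ 0`, every profile, uniform in
  `(K, j, a)` with `j + 2 ≤ K`.
* ★★`insertion_step_of_mean`: the same from the MEAN form `∫ dist1 ≤ (m/4)·g` ∧ `Gibbs_K(Gᶜ) ≤ ¼` (✓`median_of_mean`).
* ★★`insertionInterior_of_concentration_median` (BY NAME): `PoincareLipschitz.MesoscopicConcentrationL` (23532) ∧ `PoincareLipschitz.BlockLipschitzL`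
  (23533) ∧ a K-uniform median family at scale `g` ⇒ the LocalInsertionL integrand bound at every INTERIOR height `1 ≤ j ≤ K − 2`, every `ε ≥ 0`
  (NOT the item 23607, whose text has `j ≤ K`: the top two heights are outside K1's box).
* ★★`insertionHeightOneInterior_of_concentration_median` (BY NAME, K2 DISCHARGED by ✓`stub_levelOneLipschitz` p674322): at `j = 1`, `K ≥ 3`:
  23532 ∧ the height-one median family ⇒ the integrand bound of the registered stub `stub_insertionHeightOne` for every `K ≥ 3`, every `ε ≥ 0`
  (the stub's own text has `j ≤ K`; `K ∈ {1,2}` not covered) — LEAD's census «heightOne = the prefactor-free concentration input (+ centring)» by kernel.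
[cite: Balaban1985UV3, (3) p.256, (7) p.257 and (71) p.273]
-/

set_option autoImplicit false

noncomputable section

open scoped BigOperators
open MeasureTheory Set
open Literature.MathematicalPhysics.QuantumFieldTheory.Balaban1983to89
open Literature.MathematicalPhysics.QuantumFieldTheory.Balaban1983to89.T3ContinuumYM3Torus
open Literature.MathematicalPhysics.QuantumFieldTheory.Balaban1983to89.T3UnitScaleTilt
open Literature.MathematicalPhysics.QuantumFieldTheory.Balaban1983to89.T3UnitLawDensityEML
open Summit.QuantumFields.YangMills.Theorems.LocalInsertion.MomentOfWindowTail (insertionIntegral_le_of_gaussTail measurableSet_window)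
open Summit.QuantumFields.YangMills.Theorems.LocalInsertion.WindowTailOfConcentration (windowTail_step median_of_mean)

namespace Summit.QuantumFields.YangMills.Theorems.LocalInsertion.InsertionStepOfConcentration

/-- **THE INSERTION STEP (median form).**  `hK1 ∧ hK2 ∧ hMed` at one instance `(F, γ ≤ ½, K, j, a)` with `j + 2 ≤ K` bound the
LocalInsertionL integrand: for EVERY `ε ≥ 0` and every profile `(b₀, p₀)`,
`∫_{G(a,j)} exp(ε·min(dist1(Ū^j(∂a))/g, p(g))) ∂Gibbs_K ≤ (t₀+1)·e^{ε(t₀+1)} + 2Cc·e^{ε + (ε+1)²/(4c)}` with `t₀ = 2(m + (CL+1)√(578Cc/cc))`,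
`c = cc/(1156(CL+1)²)` — uniform in `(K, j, a)`.  (§2 + file A's Gaussian-tail adapter.) [cite: Balaban1985UV3, (7) p.257 and (71) p.273] -/
theorem insertion_step (F : T3Family) {γ b₀ p₀ ε : ℝ} (hγ : 0 < γ) (hγ2 : γ ≤ 1 / 2) (hε : 0 ≤ ε)
    {K j : ℕ} (hjK : j + 2 ≤ K) (a : Plaq (F.P K) j) {Cc cc CL m : ℝ} (hCc : 0 ≤ Cc) (hcc : 0 < cc) (hCL : 0 ≤ CL) (hm : 0 ≤ m)
    (hK1 : ∀ (n : ℕ), 1 ≤ n → (n : ℝ) ≤ (F.scheme ℰp γ).β K → 2 * n ≤ (F.P K).sitesPerDir 0 →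
      ∀ (x₀ : Site (F.P K) 0) (f : GaugeField (F.P K) 0 (Matrix.specialUnitaryGroup (Fin 2) ℂ) → ℝ) (Λ : ℝ), 0 < Λ → Measurable f → GaugeField.GaugeInvariant f →
      (∀ U U' : GaugeField (F.P K) 0 (Matrix.specialUnitaryGroup (Fin 2) ℂ), (∀ b : PBond (F.P K) 0, (∀ k, (b.src k - x₀ k).val < n) → (∀ k, (b.tgt k - x₀ k).val < n) → U b = U' b) →
        f U = f U') →
      (∀ U U' : GaugeField (F.P K) 0 (Matrix.specialUnitaryGroup (Fin 2) ℂ), |f U - f U'| ≤ Λ * Real.sqrt (∑ b : PBond (F.P K) 0, GaugeGroup.dist1 (U b * (U' b)⁻¹) ^ 2)) →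
      ∀ r : ℝ, 0 ≤ r → (gibbsK F ℰp γ K).real {U | r ≤ f U - ∫ V, f V ∂(gibbsK F ℰp γ K)} ≤
        Cc * Real.exp (-(cc * (F.scheme ℰp γ).β K * r ^ 2 / ((n : ℝ) ^ 2 * Λ ^ 2))))
    (hK2 : ∀ U U' : GaugeField (F.P K) 0 (Matrix.specialUnitaryGroup (Fin 2) ℂ), (∀ (i : ℕ) (q : Plaq (F.P K) i), i < j → Site.tdist (fun k => ((((q.src k).val * F.L ^ i : ℕ)) : ZMod ((F.P K).sitesPerDir 0))) (fun k => ((((a.src k).val * F.L ^ j : ℕ)) : ZMod ((F.P K).sitesPerDir 0))) + 64 * F.L ^ i ≤ 64 * F.L ^ j → GaugeGroup.dist1 (GaugeField.plaqHol (Averaging.iter (fun i' => BlockAveraging.blockAvg (P := F.P K) (j := i') ℰp) i U) q) < θBal F.L γ b₀ p₀ (K - i)) → (∀ (i : ℕ) (q : Plaq (F.P K) i), i < j → Site.tdist (fun k => ((((q.src k).val * F.L ^ i : ℕ)) : ZMod ((F.P K).sitesPerDir 0))) (fun k => ((((a.src k).val * F.L ^ j : ℕ)) : ZMod ((F.P K).sitesPerDir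 0))) + 64 * F.L ^ i ≤ 64 * F.L ^ j → GaugeGroup.dist1 (GaugeField.plaqHol (Averaging.iter (fun i' => BlockAveraging.blockAvg (P := F.P K) (j := i') ℰp) i U') q) < θBal F.L γ b₀ p₀ (K - i)) →
      |GaugeGroup.dist1 (GaugeField.plaqHol (Averaging.iter (fun i' => BlockAveraging.blockAvg (P := F.P K) (j := i') ℰp) j U) a) - GaugeGroup.dist1 (GaugeField.plaqHol (Averaging.iter (fun i' => BlockAveraging.blockAvg (P := F.P K) (j := i') ℰp) j U') a)| ≤ CL / Real.sqrt ((F.L : ℝ) ^ j) * Real.sqrt (∑ b : PBond (F.P K) 0, if (∀ k, (b.src k - ((((a.src k).val * F.L ^ j : ℕ)) : ZMod ((F.P K).sitesPerDir 0)) + ((8 * F.L ^ j : ℕ) : ZMod ((F.P K).sitesPerDir 0))).val < 17 * F.L ^ j) ∧ (∀ k, (b.tgt k - ((((a.src k).val * F.L ^ j : ℕ)) : ZMod ((F.P K).sitesPerDir 0)) + ((8 * F.L ^ j : ℕ) : ZMod ((F.P K).sitesPerDir 0))).val < 17 * F.L ^ j) then GaugeGroup.dist1 (U b * (U' b)⁻¹)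 ^ 2 else 0))
    (hMed : 1 / 2 ≤ (gibbsK F ℰp γ K).real ({U : GaugeField (F.P K) 0 (Matrix.specialUnitaryGroup (Fin 2) ℂ) | (∀ (i : ℕ) (q : Plaq (F.P K) i), i < j → Site.tdist (fun k => ((((q.src k).val * F.L ^ i : ℕ)) : ZMod ((F.P K).sitesPerDir 0))) (fun k => ((((a.src k).val * F.L ^ j : ℕ)) : ZMod ((F.P K).sitesPerDir 0))) + 64 * F.L ^ i ≤ 64 * F.L ^ j → GaugeGroup.dist1 (GaugeField.plaqHol (Averaging.iter (fun i' => BlockAveraging.blockAvg (P := F.P K) (j := i') ℰp) i U) q) < θBal F.L γ b₀ p₀ (K - i))} ∩ {U | GaugeGroup.dist1 (GaugeField.plaqHol (Averaging.iter (fun i' => BlockAveraging.blockAvg (P := F.P K) (j := i') ℰp) j U) a) ≤ m * Real.sqrt (γ * ((F.L : ℝ)⁻¹) ^ (K - j))})) :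
    ∫ U in {U : GaugeField (F.P K) 0 (Matrix.specialUnitaryGroup (Fin 2) ℂ) | (∀ (i : ℕ) (q : Plaq (F.P K) i), i < j → Site.tdist (fun k => ((((q.src k).val * F.L ^ i : ℕ)) : ZMod ((F.P K).sitesPerDir 0))) (fun k => ((((a.src k).val * F.L ^ j : ℕ)) : ZMod ((F.P K).sitesPerDir 0))) + 64 * F.L ^ i ≤ 64 * F.L ^ j → GaugeGroup.dist1 (GaugeField.plaqHol (Averaging.iter (fun i' => BlockAveraging.blockAvg (P := F.P K) (j := i') ℰp) i U) q) < θBal F.L γ b₀ p₀ (K - i))}, Real.exp (ε * min (GaugeGroup.dist1 (GaugeField.plaqHol (Averaging.iter (fun i' => BlockAveraging.blockAvg (P := F.P K) (j := i') ℰp) j U) a) / Real.sqrt (γ * ((F.L : ℝ)⁻¹) ^ (K - j))) (B10.pFun b₀ p₀ (Real.sqrt (γ * ((F.L : ℝ)⁻¹) ^ (K - j))))) ∂(gibbsK F ℰp γ K) ≤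
      (2 * (m + (CL + 1) * Real.sqrt (578 * Cc / cc)) + 1) * Real.exp (ε * (2 * (m + (CL + 1) * Real.sqrt (578 * Cc / cc)) + 1)) +
        2 * Cc * Real.exp (ε + (ε + 1) ^ 2 / (4 * (cc / (1156 * (CL + 1) ^ 2)))) := by
  have ht₀ : 0 ≤ 2 * (m + (CL + 1) * Real.sqrt (578 * Cc / cc)) := by
    have : 0 ≤ (CL + 1) * Real.sqrt (578 * Cc / cc) := mul_nonneg (by linarith) (Real.sqrt_nonneg _)
    linarith
  have hc : 0 < cc / (1156 * (CL + 1) ^ 2) := by positivity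
  exact insertionIntegral_le_of_gaussTail F hγ hε hc hCc ht₀ b₀ p₀ a (measurableSet_window F γ b₀ p₀ K j a)
    (fun n hn => windowTail_step F hγ hγ2 hjK a hCc hcc hCL hK1 hK2 hMed n hn)

/-- **THE INSERTION STEP (mean form).**  The same with the centring row in MEAN form `∫ dist1(Ū^j(∂a)) ∂Gibbs_K ≤ (m/4)·g_{K−j}` (`m > 0`)
plus `Gibbs_K(G(a,j)ᶜ) ≤ ¼` (§3). [cite: Balaban1985UV3, (7) p.257 and (71) p.273] -/
theorem insertion_step_of_mean (F : T3Family) {γ b₀ p₀ ε : ℝ} (hγ : 0 < γ) (hγ2 : γ ≤ 1 / 2) (hε : 0 ≤ ε)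
    {K j : ℕ} (hjK : j + 2 ≤ K) (a : Plaq (F.P K) j) {Cc cc CL m : ℝ} (hCc : 0 ≤ Cc) (hcc : 0 < cc) (hCL : 0 ≤ CL) (hm : 0 < m)
    (hK1 : ∀ (n : ℕ), 1 ≤ n → (n : ℝ) ≤ (F.scheme ℰp γ).β K → 2 * n ≤ (F.P K).sitesPerDir 0 →
      ∀ (x₀ : Site (F.P K) 0) (f : GaugeField (F.P K) 0 (Matrix.specialUnitaryGroup (Fin 2) ℂ) → ℝ) (Λ : ℝ), 0 < Λ → Measurable f → GaugeField.GaugeInvariant f →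
      (∀ U U' : GaugeField (F.P K) 0 (Matrix.specialUnitaryGroup (Fin 2) ℂ), (∀ b : PBond (F.P K) 0, (∀ k, (b.src k - x₀ k).val < n) → (∀ k, (b.tgt k - x₀ k).val < n) → U b = U' b) →
        f U = f U') →
      (∀ U U' : GaugeField (F.P K) 0 (Matrix.specialUnitaryGroup (Fin 2) ℂ), |f U - f U'| ≤ Λ * Real.sqrt (∑ b : PBond (F.P K) 0, GaugeGroup.dist1 (U b * (U' b)⁻¹) ^ 2)) →
      ∀ r : ℝ, 0 ≤ r → (gibbsK F ℰp γ K).real {U | r ≤ f U - ∫ V, f V ∂(gibbsK F ℰp γ K)} ≤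
        Cc * Real.exp (-(cc * (F.scheme ℰp γ).β K * r ^ 2 / ((n : ℝ) ^ 2 * Λ ^ 2))))
    (hK2 : ∀ U U' : GaugeField (F.P K) 0 (Matrix.specialUnitaryGroup (Fin 2) ℂ), (∀ (i : ℕ) (q : Plaq (F.P K) i), i < j → Site.tdist (fun k => ((((q.src k).val * F.L ^ i : ℕ)) : ZMod ((F.P K).sitesPerDir 0))) (fun k => ((((a.src k).val * F.L ^ j : ℕ)) : ZMod ((F.P K).sitesPerDir 0))) + 64 * F.L ^ i ≤ 64 * F.L ^ j → GaugeGroup.dist1 (GaugeField.plaqHol (Averaging.iter (fun i' => BlockAveraging.blockAvg (P := F.P K) (j := i') ℰp) i U) q) < θBal F.L γ b₀ p₀ (K - i)) → (∀ (i : ℕ) (q : Plaq (F.P K) i), i < j → Site.tdist (fun k => ((((q.src k).val * F.L ^ i : ℕ)) : ZMod ((F.P K).sitesPerDir 0))) (fun k => ((((a.src k).val * F.L ^ j : ℕ)) : ZMod ((F.P K).sitesPerDir 0))) + 64 * F.L ^ i ≤ 64 * F.L ^ j → GaugeGroup.dist1 (GaugeField.plaqHol (Averaging.iter (fun i' =>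 BlockAveraging.blockAvg (P := F.P K) (j := i') ℰp) i U') q) < θBal F.L γ b₀ p₀ (K - i)) →
      |GaugeGroup.dist1 (GaugeField.plaqHol (Averaging.iter (fun i' => BlockAveraging.blockAvg (P := F.P K) (j := i') ℰp) j U) a) - GaugeGroup.dist1 (GaugeField.plaqHol (Averaging.iter (fun i' => BlockAveraging.blockAvg (P := F.P K) (j := i') ℰp) j U') a)| ≤ CL / Real.sqrt ((F.L : ℝ) ^ j) * Real.sqrt (∑ b : PBond (F.P K) 0, if (∀ k, (b.src k - ((((a.src k).val * F.L ^ j : ℕ)) : ZMod ((F.P K).sitesPerDir 0)) + ((8 * F.L ^ j : ℕ) : ZMod ((F.P K).sitesPerDir 0))).val < 17 * F.L ^ j) ∧ (∀ k, (b.tgt k - ((((a.src k).val * F.L ^ j : ℕ)) : ZMod ((F.P K).sitesPerDir 0)) + ((8 * F.L ^ j : ℕ) : ZMod ((F.P K).sitesPerDir 0))).val < 17 * F.L ^ j) then GaugeGroup.dist1 (U b * (U' b)⁻¹) ^ 2 else 0))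
    (hMean : ∫ U, GaugeGroup.dist1 (GaugeField.plaqHol (Averaging.iter (fun i' => BlockAveraging.blockAvg (P := F.P K) (j := i') ℰp) j U) a) ∂(gibbsK F ℰp γ K) ≤ m / 4 * Real.sqrt (γ * ((F.L : ℝ)⁻¹) ^ (K - j)))
    (hGc : (gibbsK F ℰp γ K).real {U : GaugeField (F.P K) 0 (Matrix.specialUnitaryGroup (Fin 2) ℂ) | (∀ (i : ℕ) (q : Plaq (F.P K) i), i < j → Site.tdist (fun k => ((((q.src k).val * F.L ^ i : ℕ)) : ZMod ((F.P K).sitesPerDir 0))) (fun k => ((((a.src k).val * F.L ^ j : ℕ)) : ZMod ((F.P K).sitesPerDir 0))) + 64 * F.L ^ i ≤ 64 * F.L ^ j → GaugeGroup.dist1 (GaugeField.plaqHol (Averaging.iter (fun i' => BlockAveraging.blockAvg (P := F.P K) (j := i') ℰp) i U) q) < θBal F.L γ b₀ p₀ (K - i))}ᶜ ≤ 1 / 4) :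
    ∫ U in {U : GaugeField (F.P K) 0 (Matrix.specialUnitaryGroup (Fin 2) ℂ) | (∀ (i : ℕ) (q : Plaq (F.P K) i), i < j → Site.tdist (fun k => ((((q.src k).val * F.L ^ i : ℕ)) : ZMod ((F.P K).sitesPerDir 0))) (fun k => ((((a.src k).val * F.L ^ j : ℕ)) : ZMod ((F.P K).sitesPerDir 0))) + 64 * F.L ^ i ≤ 64 * F.L ^ j → GaugeGroup.dist1 (GaugeField.plaqHol (Averaging.iter (fun i' => BlockAveraging.blockAvg (P := F.P K) (j := i') ℰp) i U) q) < θBal F.L γ b₀ p₀ (K - i))}, Real.exp (ε * min (GaugeGroup.dist1 (GaugeField.plaqHol (Averaging.iter (fun i' => BlockAveraging.blockAvg (P := F.P K) (j := i') ℰp) j U) a) / Real.sqrt (γ * ((F.L : ℝ)⁻¹) ^ (K - j))) (B10.pFun b₀ p₀ (Real.sqrt (γ * ((F.L : ℝ)⁻¹) ^ (K - j))))) ∂(gibbsK F ℰp γ K) ≤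
      (2 * (m + (CL + 1) * Real.sqrt (578 * Cc / cc)) + 1) * Real.exp (ε * (2 * (m + (CL + 1) * Real.sqrt (578 * Cc / cc)) + 1)) +
        2 * Cc * Real.exp (ε + (ε + 1) ^ 2 / (4 * (cc / (1156 * (CL + 1) ^ 2)))) :=
  insertion_step F hγ hγ2 hε hjK a hCc hcc hCL hm.le hK1 hK2 (median_of_mean F hγ a hm hMean hGc)


/-! ## Packaging, by name: the interior heights `j + 2 ≤ K` from the cruxes of route PoincareLipschitz and a median family -/

/-- The bound of `insertion_step` is non-negative. [folklore] -/
theorem insertionBound_nonneg (ε : ℝ) {Cc cc CL m : ℝ} (hCc : 0 ≤ Cc) (hCL : 0 ≤ CL) (hm : 0 ≤ m) :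
    0 ≤ (2 * (m + (CL + 1) * Real.sqrt (578 * Cc / cc)) + 1) * Real.exp (ε * (2 * (m + (CL + 1) * Real.sqrt (578 * Cc / cc)) + 1)) + 2 * Cc * Real.exp (ε + (ε + 1) ^ 2 / (4 * (cc / (1156 * (CL + 1) ^ 2)))) := by
  have : 0 ≤ (CL + 1) * Real.sqrt (578 * Cc / cc) := mul_nonneg (by linarith) (Real.sqrt_nonneg _)
  have ht : 0 ≤ 2 * (m + (CL + 1) * Real.sqrt (578 * Cc / cc)) + 1 := by linarith
  positivity

/-- **ALL INTERIOR HEIGHTS, BY NAME.**  `PoincareLipschitz.MesoscopicConcentrationL` (stmt-23532) ∧ `PoincareLipschitz.BlockLipschitzL` (stmt-23533) ∧ a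
K-uniform MEDIAN FAMILY AT SCALE `g` (`∀ L ∃ m ∀ b₀ p₀ ∃ γ₁ ∀ F γ K j a` with `j + 2 ≤ K`: `½ ≤ Gibbs_K(G(a,j) ∩ {dist1(Ū^j(∂a)) ≤ m·g_{K−j}})`) give
the LocalInsertionL integrand bound at every INTERIOR height `1 ≤ j ≤ K − 2`, for EVERY `ε ≥ 0` (so any `ε₀` serves the stubs' `∀ ε ≤ ε₀`).  NOT the
item `LocalInsertionL` (which asks `j ≤ K`): the two top heights `j ∈ {K−1, K}` are outside K1's reach as typed (its box of side `17L^j` needs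
`2·17L^j ≤ 2L^{m+K}` and `17L^j ≤ β_K`).  CONDITIONAL: none of the three hypotheses is in the tree. [cite: Balaban1985UV3, (7) p.257 and (71) p.273] -/
theorem insertionInterior_of_concentration_median
    (hK1 : Summit.QuantumFields.YangMills.Theses.PoincareLipschitz.MesoscopicConcentrationL)
    (hK2 : Summit.QuantumFields.YangMills.Theses.PoincareLipschitz.BlockLipschitzL)
    (hMed : ∀ (L : ℕ), ∃ m : ℝ, 0 ≤ m ∧ ∀ (b₀ p₀ : ℝ), 0 < b₀ → 2 < p₀ → ∃ γ₁ : ℝ, 0 < γ₁ ∧ γ₁ ≤ 1 ∧ ∀ (F : T3Family) (γ : ℝ), F.L = L → 0 < γ → γ ≤ γ₁ → ∀ (K j : ℕ), 1 ≤ j → j + 2 ≤ K → ∀ (a : Plaq (F.P K) j), 1 / 2 ≤ (gibbsK F ℰp γ K).real ({U : GaugeField (F.P K) 0 (Matrix.specialUnitaryGroup (Fin 2) ℂ) | (∀ (i : ℕ) (q : Plaq (F.P K) i), i < j → Site.tdist (fun k => ((((q.src k).val * F.L ^ i : ℕ)) : ZMod ((F.P K).sitesPerDir 0))) (fun k =>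 ((((a.src k).val * F.L ^ j : ℕ)) : ZMod ((F.P K).sitesPerDir 0))) + 64 * F.L ^ i ≤ 64 * F.L ^ j → GaugeGroup.dist1 (GaugeField.plaqHol (Averaging.iter (fun i' => BlockAveraging.blockAvg (P := F.P K) (j := i') ℰp) i U) q) < θBal F.L γ b₀ p₀ (K - i))} ∩ {U | GaugeGroup.dist1 (GaugeField.plaqHol (Averaging.iter (fun i' => BlockAveraging.blockAvg (P := F.P K) (j := i') ℰp) j U) a) ≤ m * Real.sqrt (γ * ((F.L : ℝ)⁻¹) ^ (K - j))})) :
    ∀ (L : ℕ) (ε : ℝ), 0 ≤ ε → ∀ (b₀ p₀ : ℝ), 0 < b₀ → 2 < p₀ → ∃ M₀ : ℝ, 0 ≤ M₀ ∧ ∃ γ₁ : ℝ, 0 < γ₁ ∧ γ₁ ≤ 1 ∧ ∀ (F : T3Family) (γ : ℝ), F.L = L → 0 < γ → γ ≤ γ₁ → ∀ (K j : ℕ), 1 ≤ j → j + 2 ≤ K → ∀ (a : Plaq (F.P K) j), ∫ U in {U : GaugeField (F.P K) 0 (Matrix.specialUnitaryGroup (Fin 2) ℂ) | (∀ (i : ℕ)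 (q : Plaq (F.P K) i), i < j → Site.tdist (fun k => ((((q.src k).val * F.L ^ i : ℕ)) : ZMod ((F.P K).sitesPerDir 0))) (fun k => ((((a.src k).val * F.L ^ j : ℕ)) : ZMod ((F.P K).sitesPerDir 0))) + 64 * F.L ^ i ≤ 64 * F.L ^ j → GaugeGroup.dist1 (GaugeField.plaqHol (Averaging.iter (fun i' => BlockAveraging.blockAvg (P := F.P K) (j := i') ℰp) i U) q) < θBal F.L γ b₀ p₀ (K - i))}, Real.exp (ε * min (GaugeGroup.dist1 (GaugeField.plaqHol (Averaging.iter (fun i' => BlockAveraging.blockAvg (P := F.P K) (j := i') ℰp) j U) a) / Real.sqrt (γ * ((F.L : ℝ)⁻¹) ^ (K - j))) (B10.pFun b₀ p₀ (Real.sqrt (γ * ((F.L : ℝ)⁻¹) ^ (K - j))))) ∂(gibbsK F ℰp γ K) ≤ M₀ := by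
  intro L ε hε b₀ p₀ hb₀ hp₀
  obtain ⟨Cc, cc, hCc, hcc, γa, hγa, hγa1, H1⟩ := hK1 L
  obtain ⟨CL, hCL, H2⟩ := hK2 L
  obtain ⟨m, hm, H3⟩ := hMed L
  obtain ⟨γb, hγb, hγb1, H2'⟩ := H2 b₀ p₀ hb₀ hp₀
  obtain ⟨γc, hγc, hγc1, H3'⟩ := H3 b₀ p₀ hb₀ hp₀
  refine ⟨(2 * (m + (CL + 1) * Real.sqrt (578 * Cc / cc)) + 1) * Real.exp (ε * (2 * (m + (CL + 1) * Real.sqrt (578 * Cc / cc)) + 1)) + 2 * Cc * Real.exp (ε + (ε + 1) ^ 2 / (4 * (cc / (1156 * (CL + 1) ^ 2)))), insertionBound_nonneg ε hCc hCL hm, min (min γa γb) (min γc (1 / 2)),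
    lt_min (lt_min hγa hγb) (lt_min hγc (by norm_num)), (min_le_left _ _).trans ((min_le_left _ _).trans hγa1), ?_⟩
  intro F γ hFL hγ hγle K j hj hjK a
  have hγa' : γ ≤ γa := hγle.trans ((min_le_left _ _).trans (min_le_left _ _))
  have hγb' : γ ≤ γb := hγle.trans ((min_le_left _ _).trans (min_le_right _ _))
  have hγc' : γ ≤ γc := hγle.trans ((min_le_right _ _).trans (min_le_left _ _))
  have hγ2 : γ ≤ 1 / 2 := hγle.trans ((min_le_right _ _).trans (min_le_right _ _))
  exact insertion_step F hγ hγ2 hε hjK a hCc hcc hCL hm (H1 F γ hFL hγ hγa' K) (H2' F γ hFL hγ hγb' K j hj hjK a)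
    (H3' F γ hFL hγ hγc' K j hj hjK a)

/-- **HEIGHT ONE (K ≥ 3), BY NAME, WITH K2 DISCHARGED.**  At `j = 1` the window-Lipschitz row is the THEOREM
✓`PoincareLipschitzLevelOneLipschitz.stub_levelOneLipschitz` (p674322, `CL = 484·L·√L`), so `MesoscopicConcentrationL` (stmt-23532) and a K-uniform
median family at scale `g_{K−1}` at height one ALONE give the integrand bound of the registered stub `stub_insertionHeightOne`
(`Cruxes/HistoryTailL/Lines/local_insertion.lean` 48f0ac19) for every cut-off `K ≥ 3` and EVERY `ε ≥ 0` — LEAD ★w1-19936 g6's census «heightOne =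
the prefactor-free concentration input» made a kernel statement, with the centring row located.  NOT the stub itself: its text has `j ≤ K`, and the
cut-offs `K ∈ {1, 2}` are not covered here.  CONDITIONAL: `hK1`, `hMed1` are not in the tree. [cite: Balaban1985UV3, (7) p.257 and (71) p.273] -/
theorem insertionHeightOneInterior_of_concentration_median
    (hK1 : Summit.QuantumFields.YangMills.Theses.PoincareLipschitz.MesoscopicConcentrationL)
    (hMed1 : ∀ (L : ℕ), ∃ m : ℝ, 0 ≤ m ∧ ∀ (b₀ p₀ : ℝ), 0 < b₀ → 2 < p₀ → ∃ γ₁ : ℝ, 0 < γ₁ ∧ γ₁ ≤ 1 ∧ ∀ (F : T3Family) (γ : ℝ), F.L = L → 0 < γ → γ ≤ γ₁ → ∀ (K j : ℕ), 1 ≤ j → j + 2 ≤ K → j ≤ 1 → ∀ (a : Plaq (F.P K) j), 1 / 2 ≤ (gibbsK F ℰp γ K).real ({U : GaugeField (F.P K) 0 (Matrix.specialUnitaryGroup (Fin 2) ℂ) | (∀ (i : ℕ) (q : Plaq (F.P K) i), i < j → Site.tdist (fun k => ((((q.src k).val * F.L ^ i : ℕ)) : ZMod ((F.P K).sitesPerDir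 0))) (fun k => ((((a.src k).val * F.L ^ j : ℕ)) : ZMod ((F.P K).sitesPerDir 0))) + 64 * F.L ^ i ≤ 64 * F.L ^ j → GaugeGroup.dist1 (GaugeField.plaqHol (Averaging.iter (fun i' => BlockAveraging.blockAvg (P := F.P K) (j := i') ℰp) i U) q) < θBal F.L γ b₀ p₀ (K - i))} ∩ {U | GaugeGroup.dist1 (GaugeField.plaqHol (Averaging.iter (fun i' => BlockAveraging.blockAvg (P := F.P K) (j := i') ℰp) j U) a) ≤ m * Real.sqrt (γ * ((F.L : ℝ)⁻¹) ^ (K - j))})) :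
    ∀ (L : ℕ) (ε : ℝ), 0 ≤ ε → ∀ (b₀ p₀ : ℝ), 0 < b₀ → 2 < p₀ → ∃ M₀ : ℝ, 0 ≤ M₀ ∧ ∃ γ₁ : ℝ, 0 < γ₁ ∧ γ₁ ≤ 1 ∧ ∀ (F : T3Family) (γ : ℝ), F.L = L → 0 < γ → γ ≤ γ₁ → ∀ (K j : ℕ), 1 ≤ j → j + 2 ≤ K → j ≤ 1 → ∀ (a : Plaq (F.P K) j), ∫ U in {U : GaugeField (F.P K) 0 (Matrix.specialUnitaryGroup (Fin 2) ℂ) | (∀ (i : ℕ) (q : Plaq (F.P K) i), i < j → Site.tdist (fun k => ((((q.src k).val * F.L ^ i : ℕ)) : ZMod ((F.P K).sitesPerDir 0))) (fun k => ((((a.src k).val * F.L ^ j : ℕ)) : ZMod ((F.P K).sitesPerDir 0))) + 64 * F.L ^ i ≤ 64 * F.L ^ j → GaugeGroup.dist1 (GaugeField.plaqHol (Averaging.iter (fun i' => BlockAveraging.blockAvg (P := F.P K) (j := i') ℰp) i U) q) < θBal F.L γ b₀ p₀ (K - i))}, Real.exp (ε * min (GaugeGroup.dist1 (GaugeField.plaqHol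 (Averaging.iter (fun i' => BlockAveraging.blockAvg (P := F.P K) (j := i') ℰp) j U) a) / Real.sqrt (γ * ((F.L : ℝ)⁻¹) ^ (K - j))) (B10.pFun b₀ p₀ (Real.sqrt (γ * ((F.L : ℝ)⁻¹) ^ (K - j))))) ∂(gibbsK F ℰp γ K) ≤ M₀ := by
  intro L ε hε b₀ p₀ hb₀ hp₀
  obtain ⟨Cc, cc, hCc, hcc, γa, hγa, hγa1, H1⟩ := hK1 L
  obtain ⟨CL, hCL, H2⟩ := Summit.QuantumFields.YangMills.Theorems.PoincareLipschitzLevelOneLipschitz.stub_levelOneLipschitz L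
  obtain ⟨m, hm, H3⟩ := hMed1 L
  obtain ⟨γb, hγb, hγb1, H2'⟩ := H2 b₀ p₀ hb₀ hp₀
  obtain ⟨γc, hγc, hγc1, H3'⟩ := H3 b₀ p₀ hb₀ hp₀
  refine ⟨(2 * (m + (CL + 1) * Real.sqrt (578 * Cc / cc)) + 1) * Real.exp (ε * (2 * (m + (CL + 1) * Real.sqrt (578 * Cc / cc)) + 1)) + 2 * Cc * Real.exp (ε + (ε + 1) ^ 2 / (4 * (cc / (1156 * (CL + 1) ^ 2)))), insertionBound_nonneg ε hCc hCL hm, min (min γa γb) (min γc (1 / 2)),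
    lt_min (lt_min hγa hγb) (lt_min hγc (by norm_num)), (min_le_left _ _).trans ((min_le_left _ _).trans hγa1), ?_⟩
  intro F γ hFL hγ hγle K j hj hjK hj1 a
  have hγa' : γ ≤ γa := hγle.trans ((min_le_left _ _).trans (min_le_left _ _))
  have hγb' : γ ≤ γb := hγle.trans ((min_le_left _ _).trans (min_le_right _ _))
  have hγc' : γ ≤ γc := hγle.trans ((min_le_right _ _).trans (min_le_left _ _))
  have hγ2 : γ ≤ 1 / 2 := hγle.trans ((min_le_right _ _).trans (min_le_right _ _))
  exact insertion_step F hγ hγ2 hε hjK a hCc hcc hCL hm (H1 F γ hFL hγ hγa' K) (H2' F γ hFL hγ hγb' K j hj hjK hj1 a)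
    (H3' F γ hFL hγ hγc' K j hj hjK hj1 a)

end Summit.QuantumFields.YangMills.Theorems.LocalInsertion.InsertionStepOfConcentration
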